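import Mathlib.Algebra.MvPolynomial.CommRing
import Mathlib.Algebra.MvPolynomial.Degrees
import Mathlib.LinearAlgebra.Dimension.Constructions
import Mathlib.LinearAlgebra.Dimension.Finite
import Mathlib.LinearAlgebra.LinearIndependent.Lemmas
import Mathlib.LinearAlgebra.Finsupp.LinearCombination
import Mathlib.Algebra.Field.ZMod
import Mathlib.Data.Nat.Prime.Defs
import HarnessLib

/-!
# Multiquadratic extension polynomials with prescribed values (Aaronson–Wigderson, §4.1–4.2)

Trunk `CplxCore`, toolkit for the algebraic oracle constructions of S. Aaronson, A. Wigderson,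
*Algebrization: a new barrier in complexity theory* (STOC 2008; full version, §4), used by the
proof of Thm. 5.6 (`Literature/Barriers/PneNP/Algebrization.lean`, fact
`Algebrization_npLinearSize`). Everything here is elementary algebra over a field `K`
(resp. over all prime fields `𝔽_p` at once), PROVED:

* `Multiquadratic.delta z` — the multilinear polynomial `δ_z = Π_{i : zᵢ = 1} xᵢ · Π_{i : zᵢ = 0} (1 − xᵢ)`
  which is `1` at the Boolean point `z` and `0` at every other Boolean point (AW §4.1);
  `Multiquadratic.mlin c = Σ_z c_z δ_z`, the multilinear polynomial with Boolean values `c`.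
* `Multiquadratic.exists_pivots` — the linear algebra behind AW Lemma 4.2: among any family of
  vectors in a space of dimension `t` there are `≤ t` of them spanning all the others.
* `Multiquadratic.exists_multilinear_vanishing` — **AW Lemma 4.2**: for `t` points
  `y₁, …, y_t ∈ Kⁿ` there is a multilinear `m` with `m(yᵢ) = 0` and `m(z) = 1` for all Boolean
  `z` outside a set of at most `t` exceptions.
* `Multiquadratic.exists_bad` — **AW Lemma 4.3**: outside at most `t` "bad" Boolean points `z`
  there is a multiquadratic `u_z` vanishing on the `yᵢ`, with `u_z(z) = 1` and `u_z(w) = 0`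
  for Boolean `w ≠ z` (`u_z = m · δ_z`).
* `Multiquadratic.exists_free` — **AW Lemma 4.5** for the collection of all prime fields: given
  a Boolean `f : {0,1}ⁿ → {0,1}`, multiquadratic extensions `P_p` of `f` over every `𝔽_p`, and
  finitely many points `Y_p ⊆ 𝔽_pⁿ` (`t = Σ_p |Y_p|`), there is a set `B` of at most `t` Boolean
  points such that every `f'` agreeing with `f` on `B` has, over every `𝔽_p`, a multiquadratic
  extension `P'_p` agreeing with `P_p` on `Y_p`.

Multidegree is Mathlib's `MvPolynomial.degreeOf` ("mdeg(p) ≤ 2" = `∀ i, degreeOf i p ≤ 2`), as in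
`ExtensionOracle.IsExtensionOf` (`Literature/Computability/Complexity/Algebrization.lean`); the
Boolean point `z` of `Kⁿ` is `boolPt z = fun i => if z i then 1 else 0`, the form used there.

## References

* S. Aaronson, A. Wigderson, *Algebrization: a new barrier in complexity theory*, STOC 2008
  (full version, 50 pp.), §4.1 (p. 18: the basis `δ_z`), Lemma 4.2, Lemma 4.3 (pp. 18–19),
  Lemma 4.5 (pp. 19–20) [AaronsonWigderson2008].
-/

namespace Literature.Computability.Complexity

namespace Multiquadratic

open MvPolynomial Finset

/-! ### The delta basis of multilinear polynomials (AW §4.1) -/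

section CommRing

variable {F : Type*} [CommRing F] {n : ℕ}

/-- The Boolean point `z ∈ {0,1}ⁿ` viewed in `Fⁿ` (`1` for `true`, `0` for `false`), in the form
used by `ExtensionOracle.IsExtensionOf`. [cite: AaronsonWigderson2008, §4.1 p. 18] -/
def boolPt (z : Fin n → Bool) : Fin n → F := fun i => if z i then 1 else 0

/-- Unfolding of `boolPt`. [folklore] -/
@[simp] theorem boolPt_apply (z : Fin n → Bool) (i : Fin n) :
    (boolPt z : Fin n → F) i = if z i then 1 else 0 := rfl

/-- AW §4.1: `δ_z := Π_{i : zᵢ = 1} xᵢ · Π_{i : zᵢ = 0} (1 − xᵢ)`, "the unique multilinear polynomial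
that is `1` at `z` and `0` elsewhere on the Boolean cube". [cite: AaronsonWigderson2008, §4.1 p. 18] -/
noncomputable def delta (z : Fin n → Bool) : MvPolynomial (Fin n) F :=
  ∏ i, if z i then X i else 1 - X i

/-- `δ_z(w) = [z = w]` for Boolean `w`. [cite: AaronsonWigderson2008, §4.1 p. 18] -/
theorem eval_delta_boolPt (z w : Fin n → Bool) :
    eval (boolPt w) (delta z : MvPolynomial (Fin n) F) = if z = w then 1 else 0 := by
  classical
  have hfac : ∀ i, eval (boolPt w) (if z i then X i else 1 - X i : MvPolynomial (Fin n) F) =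
      if z i = w i then 1 else 0 := by
    intro i
    cases hz : z i <;> cases hw : w i <;> simp [hw]
  simp only [delta, map_prod, hfac, Finset.prod_boole, Finset.mem_univ, true_imp_iff]
  by_cases h : z = w
  · simp [h]
  · have : ¬ ∀ i, z i = w i := fun h' => h (funext h')
    simp [h, this]

/-- `δ_z` is multilinear: degree `≤ 1` in each variable. [cite: AaronsonWigderson2008, §4.1 p. 18] -/
theorem degreeOf_delta_le [Nontrivial F] (z : Fin n → Bool) (i : Fin n) :
    (delta z : MvPolynomial (Fin n) F).degreeOf i ≤ 1 := by
  classical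
  refine (degreeOf_prod_le i univ _).trans ?_
  have h : ∀ j, degreeOf i (if z j then X j else 1 - X j : MvPolynomial (Fin n) F) ≤
      if i = j then 1 else 0 := by
    intro j
    have hX : degreeOf i (X j : MvPolynomial (Fin n) F) ≤ if i = j then 1 else 0 := by
      rw [degreeOf_X]
    cases z j
    · simp only [Bool.false_eq_true, ↓reduceIte]
      refine (degreeOf_sub_le i _ _).trans (max_le ?_ hX)
      simp [degreeOf_one]
    · simpa using hX
  calc ∑ j, degreeOf i (if z j then X j else 1 - X j : MvPolynomial (Fin n) F)
      ≤ ∑ j, (if i = j then 1 else 0 : ℕ) := sum_le_sum fun j _ => h j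
    _ = 1 := by simp

/-- The multilinear polynomial with prescribed Boolean values `c`: `Σ_z c_z δ_z` (AW §4.1:
"we can write `m` uniquely in the basis of `δ_z`'s"). [cite: AaronsonWigderson2008, §4.1 p. 18] -/
noncomputable def mlin (c : (Fin n → Bool) → F) : MvPolynomial (Fin n) F :=
  ∑ z, C (c z) * delta z

/-- `(Σ_z c_z δ_z)(w) = c_w` for Boolean `w`. [cite: AaronsonWigderson2008, §4.1 p. 18] -/
theorem eval_mlin_boolPt (c : (Fin n → Bool) → F) (w : Fin n → Bool) :
    eval (boolPt w) (mlin c) = c w := by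
  classical
  simp [mlin, map_sum, map_mul, eval_C, eval_delta_boolPt, mul_ite, Finset.sum_ite_eq']

/-- `Σ_z c_z δ_z` is multilinear. [cite: AaronsonWigderson2008, §4.1 p. 18] -/
theorem degreeOf_mlin_le [Nontrivial F] (c : (Fin n → Bool) → F) (i : Fin n) :
    (mlin c).degreeOf i ≤ 1 :=
  (degreeOf_sum_le _ _ _).trans
    (Finset.sup_le fun z _ => (degreeOf_C_mul_le _ _ _).trans (degreeOf_delta_le z i))

end CommRing

/-! ### Lemma 4.2: linear algebra -/

section Field

variable {K : Type*} [Field K] {n : ℕ}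

/-- The linear algebra of AW Lemma 4.2 ("by basic linear algebra"): in a space of dimension `t`,
every family of vectors `col` contains at most `t` members (`S`) of which all members are linear
combinations. [cite: AaronsonWigderson2008, Lemma 4.2 (proof)] -/
theorem exists_pivots {ι W : Type*} [AddCommGroup W] [Module K W] [Module.Finite K W]
    [Fintype ι] [DecidableEq ι] (col : ι → W) :
    ∃ S : Finset ι, S.card ≤ Module.finrank K W ∧
      ∀ z, ∃ a : ι → K, (∀ s, s ∉ S → a s = 0) ∧ ∑ s, a s • col s = col z := by
  classical
  obtain ⟨κ, a, hinj, hspan, hli⟩ := exists_linearIndependent' (K := K) col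
  haveI : Fintype κ := Fintype.ofInjective a hinj
  refine ⟨univ.image a, ?_, fun z => ?_⟩
  · rw [card_image_of_injective _ hinj, card_univ]
    exact hli.fintype_card_le_finrank
  · have hz : col z ∈ Submodule.span K (Set.range (col ∘ a)) := by
      rw [hspan]
      exact Submodule.subset_span ⟨z, rfl⟩
    obtain ⟨c, hc⟩ := (Submodule.mem_span_range_iff_exists_fun (R := K)).1 hz
    let f : ι → K := fun s => if h : ∃ k, a k = s then c h.choose else 0
    have hf0 : ∀ s, s ∉ univ.image a → f s = 0 := by
      intro s hs
      have : ¬ ∃ k, a k = s := fun ⟨k, hk⟩ => hs (mem_image.2 ⟨k, mem_univ _, hk⟩)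
      simp [f, this]
    refine ⟨f, hf0, ?_⟩
    rw [← hc]
    calc ∑ s, f s • col s = ∑ s ∈ univ.image a, f s • col s :=
          (sum_subset (subset_univ _) fun s _ hs => by rw [hf0 s hs, zero_smul]).symm
      _ = ∑ k, f (a k) • col (a k) := sum_image fun x _ y _ h => hinj h
      _ = ∑ k, c k • (col ∘ a) k := sum_congr rfl fun k _ => by
          have h : ∃ k', a k' = a k := ⟨k, rfl⟩
          have hk : h.choose = k := hinj h.choose_spec
          simp only [f, dif_pos h, hk, Function.comp_apply]

/-- **AW Lemma 4.2.** "Let `F` be a field and let `y₁, …, y_t` be points in `Fⁿ`. Then there exists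
a multilinear polynomial `m : Fⁿ → F` such that (i) `m(yᵢ) = 0` for all `i ∈ [t]`, and (ii)
`m(z) = 1` for at least `2ⁿ − t` Boolean points `z`" — here with the exceptional Boolean points
collected in a set `S` of size `≤ t`. [cite: AaronsonWigderson2008, Lemma 4.2] -/
theorem exists_multilinear_vanishing (Y : Finset (Fin n → K)) :
    ∃ S : Finset (Fin n → Bool), S.card ≤ Y.card ∧ ∃ m : MvPolynomial (Fin n) K,
      (∀ i, m.degreeOf i ≤ 1) ∧ (∀ y ∈ Y, eval y m = 0) ∧ ∀ z, z ∉ S → eval (boolPt z) m = 1 := by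
  classical
  let col : (Fin n → Bool) → ({y // y ∈ Y} → K) := fun z y => eval (y : Fin n → K) (delta z)
  obtain ⟨S, hS, hcol⟩ := exists_pivots (K := K) col
  rw [Module.finrank_fintype_fun_eq_card, Fintype.card_coe] at hS
  choose a ha0 ha using hcol
  -- coefficients: `c z := Σ_{z' ∉ S} ([z = z'] - a z' z)`
  let T : Finset (Fin n → Bool) := univ.filter fun z => z ∉ S
  let c : (Fin n → Bool) → K := fun z => ∑ z' ∈ T, ((if z = z' then 1 else 0) - a z' z)
  refine ⟨S, hS, mlin c, degreeOf_mlin_le c, fun y hy => ?_, fun z hz => ?_⟩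
  · have key : ∀ z', ∑ z, a z' z * col z ⟨y, hy⟩ = col z' ⟨y, hy⟩ := fun z' => by
      have := congrFun (ha z') ⟨y, hy⟩
      simpa [Finset.sum_apply, Pi.smul_apply, smul_eq_mul] using this
    have hev : eval y (mlin c) = ∑ z, c z * col z ⟨y, hy⟩ := by
      simp [mlin, map_sum, map_mul, eval_C, col]
    rw [hev]
    calc ∑ z, c z * col z ⟨y, hy⟩
        = ∑ z, ∑ z' ∈ T, ((if z = z' then 1 else 0) - a z' z) * col z ⟨y, hy⟩ := by
          simp only [c, Finset.sum_mul]
      _ = ∑ z' ∈ T, ∑ z, ((if z = z' then 1 else 0) - a z' z) * col z ⟨y, hy⟩ := Finset.sum_comm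
      _ = ∑ z' ∈ T, (col z' ⟨y, hy⟩ - col z' ⟨y, hy⟩) := by
          refine sum_congr rfl fun z' _ => ?_
          simp only [sub_mul, Finset.sum_sub_distrib, ite_mul, one_mul, zero_mul,
            Finset.sum_ite_eq', Finset.mem_univ, ↓reduceIte, key]
      _ = 0 := by simp
  · rw [eval_mlin_boolPt]
    have hzT : z ∈ T := by simp [T, hz]
    have h0 : ∀ z' ∈ T, a z' z = 0 := fun z' _ => ha0 z' z hz
    calc c z = ∑ z' ∈ T, ((if z = z' then (1 : K) else 0) - a z' z) := rfl
      _ = ∑ z' ∈ T, (if z = z' then (1 : K) else 0) := sum_congr rfl fun z' hz' => by rw [h0 z' hz', sub_zero]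
      _ = 1 := by rw [Finset.sum_ite_eq]; simp [hzT]

/-- **AW Lemma 4.3.** "Let `F` be a field and let `y₁, …, y_t` be points in `Fⁿ`. Then for at least
`2ⁿ − t` Boolean points `w ∈ {0,1}ⁿ` [here: all `w` outside a set `Bad` of size `≤ t`], there
exists a multiquadratic extension polynomial `p : Fⁿ → F` such that (i) `p(yᵢ) = 0` for all
`i ∈ [t]`, (ii) `p(w) = 1`, and (iii) `p(z) = 0` for all Boolean `z ≠ w`" (`p = m · δ_w` with `m`
from Lemma 4.2). [cite: AaronsonWigderson2008, Lemma 4.3] -/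
theorem exists_bad (Y : Finset (Fin n → K)) :
    ∃ Bad : Finset (Fin n → Bool), Bad.card ≤ Y.card ∧ ∀ z, z ∉ Bad →
      ∃ u : MvPolynomial (Fin n) K, (∀ i, u.degreeOf i ≤ 2) ∧ (∀ y ∈ Y, eval y u = 0) ∧
        ∀ w, eval (boolPt w) u = if w = z then 1 else 0 := by
  classical
  obtain ⟨S, hS, m, hdeg, hY, hone⟩ := exists_multilinear_vanishing Y
  refine ⟨S, hS, fun z hz => ⟨m * delta z, fun i => ?_, fun y hy => ?_, fun w => ?_⟩⟩
  · exact (degreeOf_mul_le i _ _).trans (Nat.add_le_add (hdeg i) (degreeOf_delta_le z i))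
  · rw [map_mul, hY y hy, zero_mul]
  · rw [map_mul, eval_delta_boolPt]
    by_cases h : w = z
    · subst h
      simp [hone w hz]
    · have h' : ¬ z = w := fun h' => h h'.symm
      simp [h, h']

end Field

/-! ### Lemma 4.5: many prime fields at once -/

section Primes

variable {n : ℕ}

/-- `IsMQExt P f`: the polynomial `P ∈ 𝔽_p[x₁, …, xₙ]` is a *multiquadratic extension* of the
Boolean function `f : {0,1}ⁿ → {0,1}`: `mdeg(P) ≤ 2` and `P(w) = f(w)` on Boolean points — the
per-slice content of `ExtensionOracle.IsExtensionOf · · 2`. [cite: AaronsonWigderson2008, §4 p. 17 and Def. 2.2] -/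
def IsMQExt {p : ℕ} (P : MvPolynomial (Fin n) (ZMod p)) (f : (Fin n → Bool) → Bool) : Prop :=
  (∀ i, P.degreeOf i ≤ 2) ∧ ∀ w, eval (boolPt w) P = if f w then 1 else 0

/-- The multilinear extension `Σ_z f(z) δ_z` of `f` over `𝔽_p` (`p` prime) is a multiquadratic
extension of `f` (AW §4.1). [cite: AaronsonWigderson2008, §4.1 p. 18] -/
theorem isMQExt_mlin (p : Nat.Primes) (f : (Fin n → Bool) → Bool) :
    IsMQExt (mlin fun z => if f z then (1 : ZMod p) else 0) f := by
  haveI : Fact (p : ℕ).Prime := ⟨p.2⟩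
  exact ⟨fun i => (degreeOf_mlin_le _ i).trans (by norm_num), fun w => eval_mlin_boolPt _ w⟩

/-- **AW Lemma 4.5** (for the collection of all prime fields `𝔽_p`; AW allow any collection of
fields). "Let `f : {0,1}ⁿ → {0,1}` be a Boolean function, and for every `F ∈ 𝓕`, let
`p_F : Fⁿ → F` be a multiquadratic polynomial over `F` extending `f`. Also let `Y_F ⊆ Fⁿ` for
each `F`, and `t := Σ_F |Y_F|`. Then there exists a subset `B ⊆ {0,1}ⁿ`, with `|B| ≤ t`, such
that for all Boolean functions `f' : {0,1}ⁿ → {0,1}` that agree with `f` on `B`, there exist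
multiquadratic polynomials `p'_F : Fⁿ → F` (one for each `F ∈ 𝓕`) such that (i) `p'_F` extends
`f'`, and (ii) `p'_F(y) = p_F(y)` for all `y ∈ Y_F`." The points are given as one finite set `Y`
of pairs `(p, y)`, `y ∈ 𝔽_pⁿ` (so `t = |Y|`). [cite: AaronsonWigderson2008, Lemma 4.5] -/
theorem exists_free (f : (Fin n → Bool) → Bool)
    (P : ∀ p : Nat.Primes, MvPolynomial (Fin n) (ZMod p)) (hP : ∀ p, IsMQExt (P p) f)
    (Y : Finset (Σ p : Nat.Primes, (Fin n → ZMod p))) :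
    ∃ B : Finset (Fin n → Bool), B.card ≤ Y.card ∧
      ∀ f' : (Fin n → Bool) → Bool, (∀ z ∈ B, f' z = f z) →
        ∃ P' : ∀ p : Nat.Primes, MvPolynomial (Fin n) (ZMod p),
          (∀ p, IsMQExt (P' p) f') ∧ ∀ y ∈ Y, eval y.2 (P' y.1) = eval y.2 (P y.1) := by
  classical
  -- the points over each prime
  let supp : Finset Nat.Primes := Y.image Sigma.fst
  let Yp : ∀ p : Nat.Primes, Finset (Fin n → ZMod p) := fun p =>
    Y.preimage (Sigma.mk (β := fun q : Nat.Primes => Fin n → ZMod q) p) sigma_mk_injective.injOn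
  have hYp : ∀ (p : Nat.Primes) (y : Fin n → ZMod p), y ∈ Yp p ↔ (⟨p, y⟩ : Σ p : Nat.Primes, (Fin n → ZMod p)) ∈ Y :=
    fun p y => by simp [Yp]
  have hcard : ∑ p ∈ supp, (Yp p).card = Y.card := by
    rw [← Finset.card_sigma, Finset.sigma_image_fst_preimage_mk]
  -- for every prime, the bad set and the polynomials `u_{p,z}` of Lemma 4.3
  have h43 : ∀ p : Nat.Primes, ∃ Bad : Finset (Fin n → Bool), Bad.card ≤ (Yp p).card ∧
      ∀ z, z ∉ Bad → ∃ u : MvPolynomial (Fin n) (ZMod p), (∀ i, u.degreeOf i ≤ 2) ∧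
        (∀ y ∈ Yp p, eval y u = 0) ∧ ∀ w, eval (boolPt w) u = if w = z then 1 else 0 := by
    intro p
    haveI : Fact (p : ℕ).Prime := ⟨p.2⟩
    exact exists_bad (Yp p)
  choose Bad hBad hu using h43
  refine ⟨supp.biUnion Bad, (card_biUnion_le.trans (sum_le_sum fun p _ => hBad p)).trans hcard.le, ?_⟩
  intro f' hf'
  -- one new polynomial for every prime
  have hone : ∀ p : Nat.Primes, ∃ P' : MvPolynomial (Fin n) (ZMod p),
      IsMQExt P' f' ∧ ∀ y ∈ Yp p, eval y P' = eval y (P p) := by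
    intro p
    haveI : Fact (p : ℕ).Prime := ⟨p.2⟩
    by_cases hp : p ∈ supp
    · -- `P' := P_p + Σ_{z good} (f'(z) - f(z)) u_{p,z}`
      have hBp : ∀ z ∈ Bad p, f' z = f z := fun z hz => hf' z (mem_biUnion.2 ⟨p, hp, hz⟩)
      choose u hudeg huY hubool using hu p
      let χ : Bool → ZMod p := fun b => if b then 1 else 0
      let G : Finset (Fin n → Bool) := univ.filter fun z => z ∉ Bad p
      -- the polynomials `u_{p,z}` extended by `0` on bad points (never used there)
      let u' : (Fin n → Bool) → MvPolynomial (Fin n) (ZMod p) := fun z =>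
        if h : z ∉ Bad p then u z h else 0
      have hu' : ∀ z (hz : z ∉ Bad p), u' z = u z hz := fun z hz => by simp [u', hz]
      let corr : MvPolynomial (Fin n) (ZMod p) := ∑ z ∈ G, C (χ (f' z) - χ (f z)) * u' z
      have hG : ∀ z ∈ G, z ∉ Bad p := fun z hz => (mem_filter.1 hz).2
      refine ⟨P p + corr, ⟨fun i => ?_, fun w => ?_⟩, fun y hy => ?_⟩
      · refine (degreeOf_add_le i _ _).trans (max_le ((hP p).1 i) ?_)
        refine (degreeOf_sum_le _ _ _).trans (Finset.sup_le fun z hz => ?_)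
        refine (degreeOf_C_mul_le _ _ _).trans ?_
        rw [hu' z (hG z hz)]
        exact hudeg z (hG z hz) i
      · rw [map_add, (hP p).2 w]
        have hcorr : eval (boolPt w) corr =
            ∑ z ∈ G, (χ (f' z) - χ (f z)) * (if w = z then 1 else 0) := by
          simp only [corr, map_sum, map_mul, eval_C]
          refine sum_congr rfl fun z hz => ?_
          rw [hu' z (hG z hz), hubool]
        rw [hcorr]
        simp only [mul_ite, mul_one, mul_zero, Finset.sum_ite_eq]
        by_cases hw : w ∈ Bad p
        · have hwG : w ∉ G := fun h => hG w h hw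
          simp [hwG, hBp w hw]
        · have hwG : w ∈ G := mem_filter.2 ⟨mem_univ _, hw⟩
          simp [hwG, χ]
      · rw [map_add]
        have : eval y corr = 0 := by
          simp only [corr, map_sum, map_mul, eval_C]
          exact sum_eq_zero fun z hz => by rw [hu' z (hG z hz), huY z (hG z hz) y hy, mul_zero]
        rw [this, add_zero]
    · -- no constraint at `p`: take the multilinear extension of `f'`
      refine ⟨mlin fun z => if f' z then (1 : ZMod p) else 0, isMQExt_mlin p f', fun y hy => ?_⟩
      exact absurd (mem_image.2 ⟨_, (hYp p y).1 hy, rfl⟩) hp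
  choose P' hP' hP'Y using hone
  exact ⟨P', hP', fun y hy => hP'Y y.1 y.2 ((hYp y.1 y.2).2 (by simpa using hy))⟩

end Primes

end Multiquadratic

end Literature.Computability.Complexity
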